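import Literature.Geometry.Lorentzian.CoordScalarCurvatureFirstVariation
import HarnessLib

/-!
# The first variation of the momentum constraint along a family of data

Everything here is PROVED; the file introduces one explicit definition (`momFn`) and no
statement of `Prop` type.

For a smooth one-parameter family of metric components `G_s` on `V × S`
(`MetricCoord.IsMetricFamilyOn`, `h = ∂_t G = tDeriv G`, `Π = ∂_t Γ = varChrAt`) and a smooth
family `K_s` of second fundamental forms (`ContDiffOn ℝ ∞ (fun p ↦ K p.2 p.1) (V ×ˢ S)`,
`K̇ = tDeriv K`), the momentum constraint covector in coordinates

  `M(Z) = (div_G K)(Z) − ∂_Z (tr_G K) = Σ_{kl} g^{kl} (∇_{b_k} K)(b_l, Z) − ∂_Z (tr_G K)`   (`momFn`)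

(the chart form of `InitialDataSet.momentumConstraintFn`, Bartnik–Isenberg 2004, (2.2)) is
differentiable in `t` within `S`, with

  `∂_t M(Z) = Σ_{kl} ∂_t g^{kl} (∇_{b_k}K)(b_l, Z)
      + Σ_{kl} g^{kl} [(∇_{b_k}K̇)(b_l, Z) − K(Π(b_k,b_l), Z) − K(b_l, Π(b_k, Z))]
      − ∂_Z (tr_G K̇ − ⟨h, K⟩_G)`,   `∂_t g^{kl} = −(♯h♯)^{kl}`

(`IsMetricFamilyOn.hasDerivWithinAt_momFn`: the linearised momentum constraint
`DM_{(G,K)}(h, K̇)`; with `hasDerivWithinAt_hamAt` of `CoordScalarCurvatureFirstVariation.lean`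
this is the full linearised constraint map `DΦ_{(G,K)}` along the family). Ingredients:
`hasDerivWithinAt_tDeriv_of_contDiffOn`, `contDiffOn_slice_of_contDiffOn` (smooth families of
forms), `hasDerivWithinAt_fderiv_family` (mixed partials), `hasDerivWithinAt_cov₂At_family`
(`∂_t ∇K = ∇K̇ − K(Π ·, ·) − K(·, Π ·)`, Topping 2006, Prop. 2.3.1),
`derivWithin_mtrAt_family` (`∂_t tr_G K = tr_G K̇ − ⟨h, K⟩_G`), `hasDerivWithinAt_fderiv_mtrAt_family`.

## References

* R. Bartnik, J. Isenberg, *The constraint equations*, in: The Einstein equations and the large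
  scale behavior of gravitational fields, Birkhäuser 2004, §2, (2.1)–(2.2). [BartnikIsenberg2004]
* P. Topping, *Lectures on the Ricci flow*, CUP 2006, Prop. 2.3.1, 2.3.6. [Topping2006]
* A. E. Fischer, J. E. Marsden, V. Moncrief, *The structure of the space of solutions of
  Einstein's equations. I*, Ann. Inst. H. Poincaré 33 (1980), §1.
-/

noncomputable section

set_option maxSynthPendingDepth 3

open Set Filter ContinuousLinearMap Module
open scoped Topology ContDiff

namespace Literature.Geometry.Lorentzian

namespace MetricCoord

variable {E : Type*} [NormedAddCommGroup E] [NormedSpace ℝ E]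

section Defs

variable {ι : Type*} [Fintype ι] [FiniteDimensional ℝ E] (b : Basis ι ℝ E)
  (G K : E → E →L[ℝ] E →L[ℝ] ℝ)

/-- The **momentum constraint covector in coordinates** of a pair of fields of bilinear forms
`(G, K)` at `x`, written in the basis `b`:
`M(Z) = (div_G K)(Z) − ∂_Z(tr_G K) = Σ_{kl} g^{kl}(∇_{b_k}K)(b_l, Z) − ∂_Z(tr_G K)` (the chart
expression of `InitialDataSet.momentumConstraintFn`; Choquet-Bruhat 2009, Ch. VI, (3.11);
Bartnik–Isenberg 2004, (2.2)). [cite: BartnikIsenberg2004, (2.2)] -/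
def momFn (x Z : E) : ℝ :=
  ∑ k, ∑ l, ginv G b x k l * cov₂At G K x (b k) (b l) Z - fderiv ℝ (fun y ↦ mtrAt G y (K y)) x Z

/-- Unfolding lemma for `momFn`. [cite: BartnikIsenberg2004, (2.2)] -/
theorem momFn_eq (x Z : E) :
    momFn b G K x Z = ∑ k, ∑ l, ginv G b x k l * cov₂At G K x (b k) (b l) Z
      - fderiv ℝ (fun y ↦ mtrAt G y (K y)) x Z := rfl

end Defs

section Family

variable {K : ℝ → E → E →L[ℝ] E →L[ℝ] ℝ} {S : Set ℝ} {V : Set E} {x : E} {t : ℝ}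

/-- A smooth family of forms is differentiable in `t` within `S` with derivative `tDeriv K`.
[folklore] -/
theorem hasDerivWithinAt_tDeriv_of_contDiffOn (hK : ContDiffOn ℝ ∞ (fun p : E × ℝ ↦ K p.2 p.1) (V ×ˢ S))
    (hx : x ∈ V) (ht : t ∈ S) :
    HasDerivWithinAt (fun s ↦ K s x) (tDeriv K S t x) S t := by
  have h := hasDerivWithinAt_tslice (hK.differentiableOn (by simp)) hx ht
  simp only at h
  exact (h.differentiableWithinAt.hasDerivWithinAt :)

/-- The slices `K s` of a smooth family are smooth on `V`. [folklore] -/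
theorem contDiffOn_slice_of_contDiffOn (hK : ContDiffOn ℝ ∞ (fun p : E × ℝ ↦ K p.2 p.1) (V ×ˢ S))
    (ht : t ∈ S) : ContDiffOn ℝ ∞ (K t) V := by
  have hc : ContDiffOn ℝ ∞ (fun y : E ↦ (y, t)) V := contDiffOn_id.prodMk contDiffOn_const
  exact hK.comp hc fun y hy ↦ Set.mk_mem_prod hy ht

end Family

namespace IsMetricFamilyOn

variable {ι : Type*} [Fintype ι] [FiniteDimensional ℝ E] [CompleteSpace E]
  {G K : ℝ → E → E →L[ℝ] E →L[ℝ] ℝ} {S : Set ℝ} {V : Set E} {x : E} {t : ℝ} (b : Basis ι ℝ E)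
  (hG : IsMetricFamilyOn G S V) (hK : ContDiffOn ℝ ∞ (fun p : E × ℝ ↦ K p.2 p.1) (V ×ˢ S))
include hG hK

omit [Fintype ι] [FiniteDimensional ℝ E] [CompleteSpace E] in
/-- **Mixed partials for a smooth family of forms**: `∂_t (D_x K_s) = D_x (∂_t K)` within `S`.
[folklore] -/
theorem hasDerivWithinAt_fderiv_family (hx : x ∈ V) (ht : t ∈ S) :
    HasDerivWithinAt (fun s ↦ fderiv ℝ (K s) x) (fderiv ℝ (tDeriv K S t) x) S t := by
  have h := hasDerivWithinAt_fderiv_slice (F := fun p : E × ℝ ↦ K p.2 p.1) (hG.isOpen ht)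
    hG.uniqueDiffOn hK hx ht (hG.subset_closure_interior ht)
  exact h

omit [Fintype ι] [FiniteDimensional ℝ E] in
/-- **The variation of the covariant derivative of a family of forms**:
`∂_t (∇^{G_t} K_t)(W; Y, Z) = (∇ K̇)(W; Y, Z) − K(Π(W,Y), Z) − K(Y, Π(W,Z))` (`Π = ∂_t Γ`).
[cite: Topping2006, Prop. 2.3.1] -/
theorem hasDerivWithinAt_cov₂At_family (hx : x ∈ V) (ht : t ∈ S) (W Y Z : E) :
    HasDerivWithinAt (fun s ↦ cov₂At (G s) (K s) x W Y Z)
      (cov₂At (G t) (tDeriv K S t) x W Y Z - K t x (varChrAt G S t x W Y) Z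
        - K t x Y (varChrAt G S t x W Z)) S t := by
  have hD := hG.hasDerivWithinAt_fderiv_family hK hx ht
  have hD3 : HasDerivWithinAt (fun s ↦ fderiv ℝ (K s) x W Y Z) (fderiv ℝ (tDeriv K S t) x W Y Z) S t := by
    have h1 := (hD.clm_apply (hasDerivWithinAt_const t S W))
    simp only [map_zero, add_zero] at h1
    have h2 := h1.clm_apply (hasDerivWithinAt_const t S Y)
    simp only [map_zero, add_zero] at h2
    have h3 := h2.clm_apply (hasDerivWithinAt_const t S Z)
    simpa using h3
  have hKt := hasDerivWithinAt_tDeriv_of_contDiffOn hK hx ht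
  have hΓ := hG.hasDerivWithinAt_chrAt hx ht
  -- `s ↦ K s x (Γ_s W Y) Z`
  have hΓWY : HasDerivWithinAt (fun s ↦ chrAt (G s) x W Y) (varChrAt G S t x W Y) S t := by
    have h1 := hΓ.clm_apply (hasDerivWithinAt_const t S W)
    simp only [map_zero, add_zero] at h1
    have h2 := h1.clm_apply (hasDerivWithinAt_const t S Y)
    simpa using h2
  have hΓWZ : HasDerivWithinAt (fun s ↦ chrAt (G s) x W Z) (varChrAt G S t x W Z) S t := by
    have h1 := hΓ.clm_apply (hasDerivWithinAt_const t S W)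
    simp only [map_zero, add_zero] at h1
    have h2 := h1.clm_apply (hasDerivWithinAt_const t S Z)
    simpa using h2
  have hA : HasDerivWithinAt (fun s ↦ K s x (chrAt (G s) x W Y) Z)
      (tDeriv K S t x (chrAt (G t) x W Y) Z + K t x (varChrAt G S t x W Y) Z) S t := by
    have h1 := hKt.clm_apply hΓWY
    have h2 := h1.clm_apply (hasDerivWithinAt_const t S Z)
    simpa using h2
  have hB : HasDerivWithinAt (fun s ↦ K s x Y (chrAt (G s) x W Z))
      (tDeriv K S t x Y (chrAt (G t) x W Z) + K t x Y (varChrAt G S t x W Z)) S t := by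
    have h1 := hKt.clm_apply (hasDerivWithinAt_const t S Y)
    simp only [map_zero, add_zero] at h1
    have h2 := h1.clm_apply hΓWZ
    simpa using h2
  have hall := (hD3.sub hA).sub hB
  have heq : (fun s ↦ cov₂At (G s) (K s) x W Y Z) =
      fun s ↦ fderiv ℝ (K s) x W Y Z - K s x (chrAt (G s) x W Y) Z - K s x Y (chrAt (G s) x W Z) := by
    funext s; rw [cov₂At_apply]
  rw [heq]
  refine hall.congr_deriv ?_
  simp only [cov₂At_apply]
  ring

omit [Fintype ι] in
/-- `(y, s) ↦ tr_{G_s} K_s (y)` is smooth on `V × S` (a private copy of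
`contDiffOn_mtrAt_family` of `CoordFamilyRegularity.lean`, to keep the import cone small). [folklore] -/
private theorem contDiffOn_mtrAt_family' :
    ContDiffOn ℝ ∞ (fun p : E × ℝ ↦ mtrAt (G p.2) p.1 (K p.2 p.1)) (V ×ˢ S) := by
  have hs : ContDiffOn ℝ ∞ (fun q : E × ℝ ↦ sharpAt (G q.2) q.1) (V ×ˢ S) := fun q hq ↦
    (((hG.isMetricOn q.2 hq.2).isInvertible q.1 hq.1).contDiffAt_map_inverse.comp_contDiffWithinAt
      q (hG.contDiffOn q hq) :)
  have hc := hs.clm_comp hK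
  have heq : (fun p : E × ℝ ↦ mtrAt (G p.2) p.1 (K p.2 p.1)) =
      fun p ↦ traceCLM E ((sharpAt (G p.2) p.1).comp (K p.2 p.1)) := by
    funext p; rw [traceCLM_apply]; rfl
  rw [heq]
  exact (traceCLM E).contDiff.comp_contDiffOn hc

omit [Fintype ι] in
/-- **`∂_t tr_{G_t} K_t = tr_G K̇ − ⟨h, K⟩_G` as fields on `V`**: the time derivative of the
trace function within `S`. [cite: Topping2006, Prop. 2.3.6] -/
theorem derivWithin_mtrAt_family (ht : t ∈ S) {y : E} (hy : y ∈ V) :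
    derivWithin (fun s ↦ mtrAt (G s) y (K s y)) S t =
      mtrAt (G t) y (tDeriv K S t y) - pairAt (G t) y (tDeriv G S t y) (K t y) := by
  have h := hG.hasDerivWithinAt_mtrAt hy ht (hasDerivWithinAt_tDeriv_of_contDiffOn hK hy ht)
  rw [h.derivWithin (hG.uniqueDiffOn t ht), pairAt_apply]

omit [Fintype ι] in
/-- **Mixed partials for the trace**: `∂_t ∂_Z (tr_G K) = ∂_Z (tr_G K̇ − ⟨h, K⟩_G)` within `S`.
[folklore] -/
theorem hasDerivWithinAt_fderiv_mtrAt_family (hx : x ∈ V) (ht : t ∈ S) (Z : E) :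
    HasDerivWithinAt (fun s ↦ fderiv ℝ (fun y ↦ mtrAt (G s) y (K s y)) x Z)
      (fderiv ℝ (fun y ↦ mtrAt (G t) y (tDeriv K S t y) - pairAt (G t) y (tDeriv G S t y) (K t y)) x Z)
      S t := by
  have h := hasDerivWithinAt_fderiv_slice (F := fun p : E × ℝ ↦ mtrAt (G p.2) p.1 (K p.2 p.1))
    (hG.isOpen ht) hG.uniqueDiffOn (hG.contDiffOn_mtrAt_family' hK) hx ht (hG.subset_closure_interior ht)
  have h1 := h.clm_apply (hasDerivWithinAt_const t S Z)
  simp only [map_zero, add_zero] at h1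
  have h2 : HasDerivWithinAt (fun s ↦ fderiv ℝ (fun y ↦ mtrAt (G s) y (K s y)) x Z)
      (fderiv ℝ (fun y ↦ derivWithin (fun s ↦ mtrAt (G s) y (K s y)) S t) x Z) S t := by
    simpa using h1
  refine h2.congr_deriv ?_
  congr 1
  refine Filter.EventuallyEq.fderiv_eq ?_
  filter_upwards [(hG.isOpen ht).mem_nhds hx] with y hy
  exact hG.derivWithin_mtrAt_family hK ht hy

/-- **The first variation of the momentum constraint** along a smooth family of metric
components `G_s` (`h = ∂_t G`, `Π = ∂_t Γ`) and a smooth family of second fundamental forms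
`K_s` (`K̇ = ∂_t K`), at `x ∈ V` within `S` (Bartnik–Isenberg 2004, §2, the linearisation of
(2.2); Fischer–Marsden–Moncrief): for every `Z`,
`∂_t M(Z) = Σ_{kl} ∂_t g^{kl} (∇_{b_k}K)(b_l, Z)
  + Σ_{kl} g^{kl} [(∇_{b_k}K̇)(b_l, Z) − K(Π(b_k,b_l), Z) − K(b_l, Π(b_k, Z))] − ∂_Z (tr_G K̇ − ⟨h, K⟩_G)`,
with `∂_t g^{kl} = −(♯h♯)^{kl}`. [cite: BartnikIsenberg2004, (2.2)] -/
theorem hasDerivWithinAt_momFn (hx : x ∈ V) (ht : t ∈ S) (Z : E) :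
    HasDerivWithinAt (fun s ↦ momFn b (G s) (K s) x Z)
      ((∑ k, ∑ l, (b.coord k (-(sharpAt (G t) x (tDeriv G S t x (sharpAt (G t) x (coordCLM b l)))))
          * cov₂At (G t) (K t) x (b k) (b l) Z
        + ginv (G t) b x k l * (cov₂At (G t) (tDeriv K S t) x (b k) (b l) Z
          - K t x (varChrAt G S t x (b k) (b l)) Z - K t x (b l) (varChrAt G S t x (b k) Z))))
      - fderiv ℝ (fun y ↦ mtrAt (G t) y (tDeriv K S t y) - pairAt (G t) y (tDeriv G S t y) (K t y)) x Z)
      S t := by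
  have hsum : HasDerivWithinAt (fun s ↦ ∑ k, ∑ l, ginv (G s) b x k l * cov₂At (G s) (K s) x (b k) (b l) Z)
      (∑ k, ∑ l, (b.coord k (-(sharpAt (G t) x (tDeriv G S t x (sharpAt (G t) x (coordCLM b l)))))
          * cov₂At (G t) (K t) x (b k) (b l) Z
        + ginv (G t) b x k l * (cov₂At (G t) (tDeriv K S t) x (b k) (b l) Z
          - K t x (varChrAt G S t x (b k) (b l)) Z - K t x (b l) (varChrAt G S t x (b k) Z)))) S t :=
    HasDerivWithinAt.fun_sum fun k _ ↦ HasDerivWithinAt.fun_sum fun l _ ↦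
      (hG.hasDerivWithinAt_ginv b hx ht k l).mul (hG.hasDerivWithinAt_cov₂At_family hK hx ht (b k) (b l) Z)
  exact hsum.sub (hG.hasDerivWithinAt_fderiv_mtrAt_family hK hx ht Z)

end IsMetricFamilyOn

end MetricCoord

end Literature.Geometry.Lorentzian

end
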